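import Mathlib
import Literature.Analysis.SpecialFunctions.DigammaGauss
import HarnessLib

/-!
# The archimedean symbol of the Weil form is `log t − log 2 + O(1/t)`

Helper file (`--supports stmt-RiemannHypothesis-0098`), no definitions.  Seat rh-explicit-weil-5 gen12 (file of record
`HOME/rh-explicit-weil-5/WEIL5-WALL.md` §1(a); companions `Theorems/WeilWallCusp.lean`, `Theorems/WeilWallMellinSymbol.lean`).

In Yoshida's normalisation the archimedean term of Weil's hermitian form on `K(a)` is the Fourier multiplier
`R(t) = Re ψ(1/4 + it/2)`.  The wall analysis of the compressed form rests on `R(t) = log|t| − log 2 + r(t)` with `r` bounded and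
decaying, so that the compressed Weil operator is `log|D| − log 2π·𝟙 + (bounded smoothing terms)` (the `−log π` being the constant of
the explicit formula).  From the tree's Stirling-type bound `|Re ψ(w) − log ‖w‖| ≤ 1/(2‖w‖²) + π/(4|Im w|)`
(`Literature.Analysis.SpecialFunctions.Complex.abs_re_digamma_sub_log_norm_le`) at `w = 1/4 + it/2` and
`0 ≤ log ‖w‖ − log(t/2) ≤ 1/(8t²)` we get the explicit remainder bound `|R(t) − (log t − log 2)| ≤ 4/t` for `t ≥ 1`
(`abs_archSymbol_sub_log_le`).

Standard axioms only; no `sorry`.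
-/

set_option linter.dupNamespace false
set_option autoImplicit false

noncomputable section

open Complex
open scoped Real

namespace Summit.RiemannHypothesis.RiemannHypothesis.Theorems.WeilWallCusp

/-- The norm of `w = 1/4 + (t/2)i`: `‖w‖² = 1/16 + t²/4`. -/
theorem norm_sq_quarter_add_half_mul_I (t : ℝ) :
    ‖(1 / 4 : ℂ) + (t / 2 : ℝ) * I‖ ^ 2 = 1 / 16 + t ^ 2 / 4 := by
  rw [Complex.sq_norm, Complex.normSq_apply]
  simp
  ring

/-- `log(t/2) ≤ log ‖1/4 + (t/2)i‖ ≤ log(t/2) + 1/(8t²)` for `t > 0`. -/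
theorem log_norm_quarter_add_half_mul_I_bounds (t : ℝ) (ht : 0 < t) :
    Real.log (t / 2) ≤ Real.log ‖(1 / 4 : ℂ) + (t / 2 : ℝ) * I‖ ∧
      Real.log ‖(1 / 4 : ℂ) + (t / 2 : ℝ) * I‖ ≤ Real.log (t / 2) + 1 / (8 * t ^ 2) := by
  have hn2 := norm_sq_quarter_add_half_mul_I t
  have hnn : 0 ≤ ‖(1 / 4 : ℂ) + (t / 2 : ℝ) * I‖ := norm_nonneg _
  have hpos : 0 < ‖(1 / 4 : ℂ) + (t / 2 : ℝ) * I‖ := by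
    rcases hnn.eq_or_lt with h | h
    · have h2 : (0 : ℝ) < 1 / 16 + t ^ 2 / 4 := by positivity
      rw [← hn2, ← h] at h2
      norm_num at h2
    · exact h
  -- log n = log(t/2) + (1/2) log(1 + 1/(4t²)), from n² = (t/2)² (1 + 1/(4t²))
  have hlog : Real.log ‖(1 / 4 : ℂ) + (t / 2 : ℝ) * I‖ =
      Real.log (t / 2) + (1 / 2) * Real.log (1 + 1 / (4 * t ^ 2)) := by
    have h1 : ‖(1 / 4 : ℂ) + (t / 2 : ℝ) * I‖ ^ 2 = (t / 2) ^ 2 * (1 + 1 / (4 * t ^ 2)) := by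
      rw [hn2]; field_simp; ring
    have h2 : Real.log (‖(1 / 4 : ℂ) + (t / 2 : ℝ) * I‖ ^ 2) = 2 * Real.log ‖(1 / 4 : ℂ) + (t / 2 : ℝ) * I‖ := by
      rw [Real.log_pow]; norm_num
    have h3 : Real.log ((t / 2) ^ 2 * (1 + 1 / (4 * t ^ 2))) =
        2 * Real.log (t / 2) + Real.log (1 + 1 / (4 * t ^ 2)) := by
      rw [Real.log_mul (by positivity) (by positivity), Real.log_pow]; norm_num
    have h4 := congrArg Real.log h1
    rw [h2, h3] at h4
    linarith
  have hlo : 0 ≤ Real.log (1 + 1 / (4 * t ^ 2)) := Real.log_nonneg (by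
    have : (0 : ℝ) ≤ 1 / (4 * t ^ 2) := by positivity
    linarith)
  have hhi : Real.log (1 + 1 / (4 * t ^ 2)) ≤ 1 / (4 * t ^ 2) := by
    have := Real.log_le_sub_one_of_pos (show (0 : ℝ) < 1 + 1 / (4 * t ^ 2) by positivity)
    linarith
  constructor
  · rw [hlog]; linarith
  · rw [hlog]
    have h8 : (1 / 2 : ℝ) * Real.log (1 + 1 / (4 * t ^ 2)) ≤ 1 / (8 * t ^ 2) := by
      have : (1 : ℝ) / (8 * t ^ 2) = (1 / 2) * (1 / (4 * t ^ 2)) := by field_simp; ring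
      rw [this]; exact mul_le_mul_of_nonneg_left hhi (by norm_num)
    linarith

/-- THE ARCHIMEDEAN SYMBOL IS `log t − log 2` UP TO `4/t`:  `|Re ψ(1/4 + it/2) − (log t − log 2)| ≤ 4/t` for `t ≥ 1`. -/
theorem abs_archSymbol_sub_log_le (t : ℝ) (ht : 1 ≤ t) :
    |(digamma ((1 / 4 : ℂ) + (t / 2 : ℝ) * I)).re - (Real.log t - Real.log 2)| ≤ 4 / t := by
  have ht0 : 0 < t := by linarith
  set w : ℂ := (1 / 4 : ℂ) + (t / 2 : ℝ) * I with hw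
  have hre : w.re = 1 / 4 := by simp [hw]
  have him : w.im = t / 2 := by simp [hw]
  have hwre : 0 < w.re := by rw [hre]; norm_num
  have hwim : w.im ≠ 0 := by rw [him]; positivity
  have hbound := Literature.Analysis.SpecialFunctions.Complex.abs_re_digamma_sub_log_norm_le hwre hwim
  have hn2 : ‖w‖ ^ 2 = 1 / 16 + t ^ 2 / 4 := norm_sq_quarter_add_half_mul_I t
  obtain ⟨hlo, hhi⟩ := log_norm_quarter_add_half_mul_I_bounds t ht0
  have hlogt2 : Real.log (t / 2) = Real.log t - Real.log 2 := Real.log_div (by positivity) (by norm_num)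
  -- bound the two Stirling terms by 2/t and π/(2t)
  have h1 : 1 / (2 * ‖w‖ ^ 2) ≤ 2 / t := by
    rw [hn2]
    rw [div_le_div_iff₀ (by positivity) (by positivity)]
    nlinarith
  have h2 : π / (4 * |w.im|) ≤ 8 / (5 * t) := by
    rw [him, abs_of_pos (by positivity)]
    rw [div_le_div_iff₀ (by positivity) (by positivity)]
    nlinarith [Real.pi_lt_d2]
  have h3 : 1 / (8 * t ^ 2) ≤ 1 / (8 * t) := by
    apply div_le_div_of_nonneg_left (by norm_num) (by positivity)
    nlinarith
  -- combine: |R − log(t/2)| ≤ |R − log‖w‖| + (log‖w‖ − log(t/2))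
  have key : |(digamma w).re - (Real.log t - Real.log 2)| ≤
      |(digamma w).re - Real.log ‖w‖| + (Real.log ‖w‖ - Real.log (t / 2)) := by
    rw [← hlogt2]
    have htri := abs_sub_le ((digamma w).re) (Real.log ‖w‖) (Real.log (t / 2))
    have hnn : |Real.log ‖w‖ - Real.log (t / 2)| = Real.log ‖w‖ - Real.log (t / 2) := abs_of_nonneg (by linarith)
    rw [hnn] at htri
    exact htri
  have hsum : 2 / t + 8 / (5 * t) + 1 / (8 * t) ≤ 4 / t := by
    have : 2 / t + 8 / (5 * t) + 1 / (8 * t) = (149 / 40) / t := by field_simp; ring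
    rw [this]
    exact div_le_div_of_nonneg_right (by norm_num) ht0.le
  calc |(digamma w).re - (Real.log t - Real.log 2)|
      ≤ |(digamma w).re - Real.log ‖w‖| + (Real.log ‖w‖ - Real.log (t / 2)) := key
    _ ≤ (1 / (2 * ‖w‖ ^ 2) + π / (4 * |w.im|)) + 1 / (8 * t ^ 2) := by linarith
    _ ≤ 2 / t + 8 / (5 * t) + 1 / (8 * t) := by linarith
    _ ≤ 4 / t := hsum

end Summit.RiemannHypothesis.RiemannHypothesis.Theorems.WeilWallCusp

end
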